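import Summits.NavierStokesRegularity.NavierStokesRegularity.Theorems.SymmetricScarExists.Negative.SpiralWorld

/-!
# `SymmetricScarExists` (crux stmt-NavierStokesRegularity-11718, route RellichScar): inside the
# route's own belief system the crux IS the target — negative-side support, part 7 (cdisprove seat, gen 3)

`X = NoApexTypeIProfile` (the route target: no singular apex Type-I profile) trivially implies the crux
`S = SymmetricScarExists` (empty antecedent).  Conversely, granting the route's rank-2 crux
`ScarRigidity` and the three bookkeeping/known supports `SimilarityCovariance`, `SelfSimilarApexFatal`
(Tsai 1998) and `AxisymmetricApexFatal` (Seregin–Šverák 2009), the CONCLUSION of `S` can never be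
instantiated (`not_symScarWitness_of_scarRigidity`: a homogeneous-scar profile is identified by
`ScarRigidity` with all its rescalings, hence a.e. self-similar, hence dead; an axisymmetric-scar one
likewise), so `S` collapses to "its antecedent is empty", i.e. to `X`
(`symmetricScarExists_iff_noApexTypeIProfile`).  Consequences recorded for graders and planners:

* every line for `S` that does not refute `ScarRigidity` is a line for `X` restricted to nothing — the
  crux splits off no difficulty from the target (`noApexTypeIProfile_of_symmetricScarExists` is the
  planner's `target_of_cruxes` with `S` as the only open input besides `ScarRigidity`);
* in ANY world with a singular apex profile, `S` and `ScarRigidity` cannot both hold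
  (`not_symmetricScarExists_and_scarRigidity_of_apex`): a non-vacuous proof of the crux refutes the
  sibling crux, given the three supports.

(Gen 1 of this seat proved the same equivalence in its evidence file `Disproof.lean` of
2026-08-15T22:21Z, §1 "costume"; it is landed here so that it can be imported.)

## References

* T.-P. Tsai, ARMA 143 (1998), Thm 2; G. Seregin, V. Šverák, Comm. PDE 34 (2009), Thm 3.1 — the two
  Liouville kills behind the Fatal supports. [Tsai1998] [SereginSverak2009]
-/

noncomputable section

open MeasureTheory Set Function Filter Topology TopologicalSpace Metric
open scoped NNReal ENNReal

namespace Summit.NavierStokesRegularity.NavierStokesRegularity.Theorems.SymmetricScarExists.Negative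

open Literature.Analysis.FluidPDE
open Summit.NavierStokesRegularity.NavierStokesRegularity.Theses.RellichScar

section TargetCostume

/-- The target implies the crux (vacuously: no singular apex profile feeds the antecedent). [folklore] -/
theorem symmetricScarExists_of_noApexTypeIProfile (hX : NoApexTypeIProfile) : SymmetricScarExists := by
  intro C hex
  obtain ⟨u, p, G, hsw, hwg, hI, hdec, hsing⟩ := hex
  exact absurd hsing (hX u p G C hsw hwg hI hdec)

/-- **Under `ScarRigidity` and the three supports the crux's conclusion is never instantiated**: no
singular apex profile has a homogeneous or an axisymmetric scar.  Homogeneous scar ⇒ (covariance +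
rigidity) a.e. self-similar ⇒ `SelfSimilarApexFatal`; axisymmetric scar ⇒ a.e. axisymmetric ⇒
`AxisymmetricApexFatal`. [cite: Tsai1998, Thm 2; SereginSverak2009, Thm 3.1] -/
theorem not_symScarWitness_of_scarRigidity (hSR : ScarRigidity) (hCov : SimilarityCovariance)
    (hSS : SelfSimilarApexFatal) (hAx : AxisymmetricApexFatal) :
    ¬ ∃ (C' : ℝ) (u : ℝ → (EuclideanSpace ℝ (Fin 3)) → (EuclideanSpace ℝ (Fin 3))) (p : ℝ → (EuclideanSpace ℝ (Fin 3)) → ℝ) (G : ℝ → (EuclideanSpace ℝ (Fin 3)) → (EuclideanSpace ℝ (Fin 3)) →L[ℝ] (EuclideanSpace ℝ (Fin 3))),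
      IsSuitableWeakSolutionOn (slab (EuclideanSpace ℝ (Fin 3)) (Iio (0 : ℝ)) isOpen_Iio) 1 0 u p ∧ HasWeakSpatialGradientOn (slab (EuclideanSpace ℝ (Fin 3)) (Iio (0 : ℝ)) isOpen_Iio) u G ∧
      typeIBound (Iio (0 : ℝ) ×ˢ univ) u p G < ⊤ ∧ HasTypeIDecay C' u ∧
      IsBackwardSingularPoint u 0 ∧ (HomScar u ∨ AxiScar u) := by
  rintro ⟨C', z, pz, Gz, hsz, hgz, hIz, hdz, hsingz, hsym⟩
  rcases hsym with hhom | hax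
  · refine hSS z pz Gz C' hsz hgz hIz hdz hsingz fun lam hlam => ?_
    obtain ⟨q₁, H₁, hs₁, hg₁, hI₁, hd₁, hsing₁⟩ := (hCov z pz Gz C' hsz hgz hIz hdz hsingz).1 lam hlam
    exact hSR _ q₁ H₁ z pz Gz C' hs₁ hg₁ hI₁ hd₁ hsz hgz hIz hdz hsing₁ hsingz (hhom lam hlam)
  · refine hAx z pz Gz C' hsz hgz hIz hdz hsingz fun θ => ?_
    obtain ⟨q₁, H₁, hs₁, hg₁, hI₁, hd₁, hsing₁⟩ := (hCov z pz Gz C' hsz hgz hIz hdz hsingz).2 θ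
    exact hSR _ q₁ H₁ z pz Gz C' hs₁ hg₁ hI₁ hd₁ hsz hgz hIz hdz hsing₁ hsingz (hax θ)

/-- **Given `ScarRigidity` and the three supports, the crux implies the target** (the planner's
`target_of_cruxes`, isolated): the antecedent must be empty since the conclusion cannot be met.
[cite: Tsai1998, Thm 2; SereginSverak2009, Thm 3.1] -/
theorem noApexTypeIProfile_of_symmetricScarExists (hSR : ScarRigidity) (hCov : SimilarityCovariance)
    (hSS : SelfSimilarApexFatal) (hAx : AxisymmetricApexFatal) (hZ : SymmetricScarExists) :
    NoApexTypeIProfile := by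
  intro u p G C hsw hwg hI hdec hsing
  exact not_symScarWitness_of_scarRigidity hSR hCov hSS hAx (hZ C ⟨u, p, G, hsw, hwg, hI, hdec, hsing⟩)

/-- **The costume**: under `ScarRigidity` + `SimilarityCovariance` + the two Fatal supports — all
items of this very route — the crux `SymmetricScarExists` is EQUIVALENT to the route target
`NoApexTypeIProfile`.  The crux therefore carries no difficulty of its own inside the route's belief
system; graded as a line, it is the target restricted to the apex class.
[cite: Tsai1998, Thm 2; SereginSverak2009, Thm 3.1] -/
theorem symmetricScarExists_iff_noApexTypeIProfile (hSR : ScarRigidity) (hCov : SimilarityCovariance)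
    (hSS : SelfSimilarApexFatal) (hAx : AxisymmetricApexFatal) :
    SymmetricScarExists ↔ NoApexTypeIProfile :=
  ⟨noApexTypeIProfile_of_symmetricScarExists hSR hCov hSS hAx, symmetricScarExists_of_noApexTypeIProfile⟩

/-- **In any world with a singular apex profile, the two cruxes of the route exclude each other**
(given the three supports): `¬ (SymmetricScarExists ∧ ScarRigidity)`.  A non-vacuous proof of the crux
is a refutation of `ScarRigidity`, and vice versa. [cite: Tsai1998, Thm 2; SereginSverak2009, Thm 3.1] -/
theorem not_symmetricScarExists_and_scarRigidity_of_apex (hCov : SimilarityCovariance)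
    (hSS : SelfSimilarApexFatal) (hAx : AxisymmetricApexFatal)
    (hex : ∃ (C : ℝ) (u : ℝ → (EuclideanSpace ℝ (Fin 3)) → (EuclideanSpace ℝ (Fin 3))) (p : ℝ → (EuclideanSpace ℝ (Fin 3)) → ℝ) (G : ℝ → (EuclideanSpace ℝ (Fin 3)) → (EuclideanSpace ℝ (Fin 3)) →L[ℝ] (EuclideanSpace ℝ (Fin 3))),
      IsSuitableWeakSolutionOn (slab (EuclideanSpace ℝ (Fin 3)) (Iio (0 : ℝ)) isOpen_Iio) 1 0 u p ∧ HasWeakSpatialGradientOn (slab (EuclideanSpace ℝ (Fin 3)) (Iio (0 : ℝ)) isOpen_Iio) u G ∧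
      typeIBound (Iio (0 : ℝ) ×ˢ univ) u p G < ⊤ ∧ HasTypeIDecay C u ∧ IsBackwardSingularPoint u 0) :
    ¬ (SymmetricScarExists ∧ ScarRigidity) := by
  rintro ⟨hZ, hSR⟩
  obtain ⟨C, u, p, G, hsw, hwg, hI, hdec, hsing⟩ := hex
  exact noApexTypeIProfile_of_symmetricScarExists hSR hCov hSS hAx hZ u p G C hsw hwg hI hdec hsing

/-- Equivalently: the three supports and a singular apex profile turn the crux into `¬ ScarRigidity`.
[cite: Tsai1998, Thm 2; SereginSverak2009, Thm 3.1] -/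
theorem not_scarRigidity_of_symmetricScarExists_of_apex (hCov : SimilarityCovariance)
    (hSS : SelfSimilarApexFatal) (hAx : AxisymmetricApexFatal)
    (hex : ∃ (C : ℝ) (u : ℝ → (EuclideanSpace ℝ (Fin 3)) → (EuclideanSpace ℝ (Fin 3))) (p : ℝ → (EuclideanSpace ℝ (Fin 3)) → ℝ) (G : ℝ → (EuclideanSpace ℝ (Fin 3)) → (EuclideanSpace ℝ (Fin 3)) →L[ℝ] (EuclideanSpace ℝ (Fin 3))),
      IsSuitableWeakSolutionOn (slab (EuclideanSpace ℝ (Fin 3)) (Iio (0 : ℝ)) isOpen_Iio) 1 0 u p ∧ HasWeakSpatialGradientOn (slab (EuclideanSpace ℝ (Fin 3)) (Iio (0 : ℝ)) isOpen_Iio) u G ∧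
      typeIBound (Iio (0 : ℝ) ×ˢ univ) u p G < ⊤ ∧ HasTypeIDecay C u ∧ IsBackwardSingularPoint u 0)
    (hZ : SymmetricScarExists) : ¬ ScarRigidity := fun hSR =>
  not_symmetricScarExists_and_scarRigidity_of_apex hCov hSS hAx hex ⟨hZ, hSR⟩

end TargetCostume

end Summit.NavierStokesRegularity.NavierStokesRegularity.Theorems.SymmetricScarExists.Negative
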